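import Summits.AtomisticToContinuum.FouriersLaw.Theorems.HonestZwanzigRobinCoercivitySymbolNonnegSections

/-!
# `HonestZwanzig.RobinCoercivity`, line `limit-operator-memory-form`: every bulk symbol is nonnegative (part 2 of 2)

Support file for the crux `stmt-AtomisticToContinuum-12695` (`RobinCoercivity` of route `HonestZwanzig`, sub-problem
`FouriersLaw`), line `limit-operator-memory-form`, registered stub `stub_symbolPositivity` (Q1). The stub asks that every
bulk Toeplitz limit `K` of the block memory matrix `W_N(s)` (in the sense of `stub_bulkLimit`, rev 2: entrywise at every
fixed mutual distance, uniformly over bulk positions, for `N` large and `s ↓ 0`) has cosine symbol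
`K̂(θ) = Σ'_z K(z) cos(zθ) > 0` at every `θ`. This file proves, sorry-free, the LOWER HALF `K̂(θ) ≥ 0`
(`symbol_nonneg_of_bulkLimit`, same hypotheses as the stub), so that the open content of the stub is exactly the absence of a
zero of `K̂` (at `θ = 0`: the route's `PositiveMemory`; at `θ ≠ 0`: per-wavelength relaxation, no landed source).

Proof. `fejer_window`: testing the positive-semidefinite `W_N(s)` (`bulk_block_nonneg`, part 1) with the cosine and the
sine profile of wavenumber `θ` on a window of `M` consecutive bulk positions and comparing entrywise with `K` gives the
Fejér sums `Σ_{a,b<M} K(a−b) cos((a−b)θ) ≥ −M²ε` for every `ε > 0`, hence `≥ 0`; `tsum_nonneg_of_sections` (part 1)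
turns this into `Σ'_z K(z)cos(zθ) ≥ 0` (Toeplitz–Carathéodory–Herglotz positivity of the symbol of a positive Toeplitz
family).
-/

noncomputable section

open MeasureTheory Finset Matrix Filter Topology
open Literature.MathematicalPhysics.KineticTheory.HeatConduction
open Summit.AtomisticToContinuum.FouriersLaw.Theses.HonestZwanzig

namespace Summit.AtomisticToContinuum.FouriersLaw.Theorems.HonestZwanzig.Robin

/-! ### The Fejér sums of a bulk limit are nonnegative -/

/-- **Window test.** At fixed `N ≥ 2`: if the bond block of `W_N(s)` is entrywise `ε`-close to the Toeplitz matrix of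
`K` on the bulk positions `R+1 … N−1−R` at mutual distance `≤ Z`, for `0 < s < s₀` (the per-`N` clause of
`stub_bulkLimit`, rev 2), then for every
window length `M ≤ Z` with `2R + 2 + M ≤ N` and every `θ`, the Fejér sum `Σ_{a,b<M} K(a−b)cos((a−b)θ)` is `≥ −M²ε`:
test `bulk_block_nonneg` with the cosine and the sine profile of wavenumber `θ` on the window `R+1 … R+M`. -/
theorem fejer_window {ω₂ lam β γ T : ℝ} (hω : 0 < ω₂) (hl : 0 < lam) (hβ : 0 < β) (hγ : 0 < γ) (hT : 0 < T)
    {N : ℕ} (hN : 2 ≤ N) (K : ℤ → ℝ) (θ ε s₀ : ℝ) (hs₀ : 0 < s₀) (R M Z : ℕ) (hRM : 2 * R + 2 + M ≤ N) (hMZ : M ≤ Z)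
    (hbulk : ∀ (lap : ℝ → (PhaseSpace N → ℝ) → (PhaseSpace N → ℝ) → ℝ) (e : Fin N → PhaseSpace N → ℝ)
      (G : ℝ → Matrix (Fin N) (Fin N) ℝ) (schur : ℝ → (PhaseSpace N → ℝ) → (PhaseSpace N → ℝ) → ℝ)
      (g : Fin (N + 1) → PhaseSpace N → ℝ) (W : ℝ → Fin (N + 1) → Fin (N + 1) → ℝ),
    (∀ s f₁ f₂, lap s f₁ f₂ = ∫ t in Set.Ioi (0 : ℝ), Real.exp (-(s * t)) *
      ((∫ z, f₁ z * (∫ y, f₂ y ∂((pinnedChain ω₂ lam β γ).transitionKernel N T T t.toNNReal z))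
          ∂(pinnedChain ω₂ lam β γ).gibbsMeasure N T) -
        (∫ z, f₁ z ∂(pinnedChain ω₂ lam β γ).gibbsMeasure N T) *
          (∫ z, f₂ z ∂(pinnedChain ω₂ lam β γ).gibbsMeasure N T))) →
    (∀ x z, e x z = z.2 x ^ 2 / 2 + (pinnedChain ω₂ lam β γ).U (z.1 x) +
      ∑ j : Fin N, ((if j.val = x.val + 1 then (pinnedChain ω₂ lam β γ).V (z.1 j - z.1 x) / 2 else 0) +
        (if x.val = j.val + 1 then (pinnedChain ω₂ lam β γ).V (z.1 x - z.1 j) / 2 else 0))) →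
    (∀ s, G s = Matrix.of fun x y => lap s (e x) (e y)) →
    (∀ s f₁ f₂, schur s f₁ f₂ = lap s f₁ f₂ - ∑ x, ∑ y, lap s f₁ (e x) * (G s)⁻¹ x y * lap s (e y) f₂) →
    (∀ i z, g i z = (∑ b : Fin N, if b.val + 1 = i.val then (pinnedChain ω₂ lam β γ).bondCurrent N b z else 0) +
      (∑ x : Fin N, if (i.val = 0 ∧ x.val = 0) ∨ (i.val = N ∧ x.val + 1 = N) then
        (pinnedChain ω₂ lam β γ).γ * (T - z.2 x ^ 2) else 0)) →
    (∀ s i j, W s i j = (if i = j ∧ (i.val = 0 ∨ i.val = N) then (pinnedChain ω₂ lam β γ).γ * T ^ 2 else 0) -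
      schur s (fun z => g i (z.1, -z.2)) (g j)) →
    ∀ s : ℝ, 0 < s → s < s₀ → ∀ i j : Fin (N + 1),
      R + 1 ≤ i.val → i.val + 1 + R ≤ N → R + 1 ≤ j.val → j.val + 1 + R ≤ N →
      i.val ≤ j.val + Z → j.val ≤ i.val + Z → |W s i j - K ((i.val : ℤ) - j.val)| ≤ ε)
    (lap : ℝ → (PhaseSpace N → ℝ) → (PhaseSpace N → ℝ) → ℝ) (e : Fin N → PhaseSpace N → ℝ)
    (G : ℝ → Matrix (Fin N) (Fin N) ℝ) (schur : ℝ → (PhaseSpace N → ℝ) → (PhaseSpace N → ℝ) → ℝ)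
    (g : Fin (N + 1) → PhaseSpace N → ℝ) (W : ℝ → Fin (N + 1) → Fin (N + 1) → ℝ)
    (hlap : ∀ s f₁ f₂, lap s f₁ f₂ = ∫ t in Set.Ioi (0 : ℝ), Real.exp (-(s * t)) *
      ((∫ z, f₁ z * (∫ y, f₂ y ∂((pinnedChain ω₂ lam β γ).transitionKernel N T T t.toNNReal z))
          ∂(pinnedChain ω₂ lam β γ).gibbsMeasure N T) -
        (∫ z, f₁ z ∂(pinnedChain ω₂ lam β γ).gibbsMeasure N T) *
          (∫ z, f₂ z ∂(pinnedChain ω₂ lam β γ).gibbsMeasure N T)))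
    (he : ∀ x z, e x z = z.2 x ^ 2 / 2 + (pinnedChain ω₂ lam β γ).U (z.1 x) +
      ∑ j : Fin N, ((if j.val = x.val + 1 then (pinnedChain ω₂ lam β γ).V (z.1 j - z.1 x) / 2 else 0) +
        (if x.val = j.val + 1 then (pinnedChain ω₂ lam β γ).V (z.1 x - z.1 j) / 2 else 0)))
    (hG : ∀ s, G s = Matrix.of fun x y => lap s (e x) (e y))
    (hschur : ∀ s f₁ f₂, schur s f₁ f₂ = lap s f₁ f₂ - ∑ x, ∑ y, lap s f₁ (e x) * (G s)⁻¹ x y * lap s (e y) f₂)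
    (hg : ∀ i z, g i z = (∑ b : Fin N, if b.val + 1 = i.val then (pinnedChain ω₂ lam β γ).bondCurrent N b z else 0) +
      (∑ x : Fin N, if (i.val = 0 ∧ x.val = 0) ∨ (i.val = N ∧ x.val + 1 = N) then
        (pinnedChain ω₂ lam β γ).γ * (T - z.2 x ^ 2) else 0))
    (hW : ∀ s i j, W s i j = (if i = j ∧ (i.val = 0 ∨ i.val = N) then (pinnedChain ω₂ lam β γ).γ * T ^ 2 else 0) -
      schur s (fun z => g i (z.1, -z.2)) (g j)) :
    -((M : ℝ) ^ 2 * ε) ≤ ∑ a ∈ range M, ∑ b ∈ range M, K ((a : ℤ) - b) * Real.cos ((((a : ℤ) - b : ℤ) : ℝ) * θ) := by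
  have hs : 0 < s₀ / 2 := half_pos hs₀
  have hb := hbulk lap e G schur g W hlap he hG hschur hg hW (s₀ / 2) hs (half_lt_self hs₀)
  have hAM : R + 1 + M ≤ N + 1 := by omega
  -- window indicator and the two test profiles
  set χ : Fin (N + 1) → ℝ := fun i => if R + 1 ≤ i.val ∧ i.val < R + 1 + M then (1 : ℝ) else 0 with hχ
  set c : Fin (N + 1) → ℝ := fun i => χ i * Real.cos (i.val * θ) with hc
  set d : Fin (N + 1) → ℝ := fun i => χ i * Real.sin (i.val * θ) with hd
  have hχ0 : ∀ i : Fin (N + 1), i.val = 0 ∨ i.val = N → χ i = 0 := by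
    intro i hi
    rw [hχ]
    exact if_neg (by omega)
  have hpc := bulk_block_nonneg hω hl hβ hγ hT hN lap e G schur g W hlap he hG hschur hg hW hs c
    (fun i hi => by rw [hc]; simp [hχ0 i hi])
  have hpd := bulk_block_nonneg hω hl hβ hγ hT hN lap e G schur g W hlap he hG hschur hg hW hs d
    (fun i hi => by rw [hd]; simp [hχ0 i hi])
  -- `c_i c_j + d_i d_j = χ_i χ_j cos((i - j)θ)`
  have hcd : ∀ i j : Fin (N + 1), c i * W (s₀ / 2) i j * c j + d i * W (s₀ / 2) i j * d j =
      χ i * χ j * Real.cos ((((i.val : ℤ) - j.val : ℤ) : ℝ) * θ) * W (s₀ / 2) i j := by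
    intro i j
    have : (((i.val : ℤ) - j.val : ℤ) : ℝ) * θ = i.val * θ - j.val * θ := by push_cast; ring
    rw [this, Real.cos_sub, hc, hd]
    ring
  have h1 : 0 ≤ ∑ i, ∑ j, χ i * χ j * Real.cos ((((i.val : ℤ) - j.val : ℤ) : ℝ) * θ) * W (s₀ / 2) i j := by
    have : ∑ i, ∑ j, χ i * χ j * Real.cos ((((i.val : ℤ) - j.val : ℤ) : ℝ) * θ) * W (s₀ / 2) i j =
        (∑ i, ∑ j, c i * W (s₀ / 2) i j * c j) + ∑ i, ∑ j, d i * W (s₀ / 2) i j * d j := by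
      rw [← Finset.sum_add_distrib]
      refine Finset.sum_congr rfl fun i _ => ?_
      rw [← Finset.sum_add_distrib]
      exact Finset.sum_congr rfl fun j _ => (hcd i j).symm
    rw [this]
    exact add_nonneg hpc hpd
  -- entrywise comparison with the Toeplitz matrix of `K` on the window
  have h2 : ∀ i j : Fin (N + 1), χ i * χ j * Real.cos ((((i.val : ℤ) - j.val : ℤ) : ℝ) * θ) * W (s₀ / 2) i j ≤
      χ i * χ j * Real.cos ((((i.val : ℤ) - j.val : ℤ) : ℝ) * θ) * K ((i.val : ℤ) - j.val) + χ i * χ j * ε := by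
    intro i j
    by_cases hi : R + 1 ≤ i.val ∧ i.val < R + 1 + M
    · by_cases hj : R + 1 ≤ j.val ∧ j.val < R + 1 + M
      · have hij := hb i j hi.1 (by omega) hj.1 (by omega) (by omega) (by omega)
        have hχi : χ i = 1 := if_pos hi
        have hχj : χ j = 1 := if_pos hj
        rw [hχi, hχj]
        have hcos := Real.abs_cos_le_one ((((i.val : ℤ) - j.val : ℤ) : ℝ) * θ)
        have hprod : |Real.cos ((((i.val : ℤ) - j.val : ℤ) : ℝ) * θ) * (W (s₀ / 2) i j - K ((i.val : ℤ) - j.val))| ≤ ε := by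
          rw [abs_mul]
          calc |Real.cos ((((i.val : ℤ) - j.val : ℤ) : ℝ) * θ)| * |W (s₀ / 2) i j - K ((i.val : ℤ) - j.val)|
              ≤ 1 * ε := mul_le_mul hcos hij (abs_nonneg _) zero_le_one
            _ = ε := one_mul ε
        have := (le_abs_self _).trans hprod
        nlinarith [this]
      · have hχj : χ j = 0 := if_neg hj
        simp [hχj]
    · have hχi : χ i = 0 := if_neg hi
      simp [hχi]
  have h3 : ∑ i, ∑ j, χ i * χ j * Real.cos ((((i.val : ℤ) - j.val : ℤ) : ℝ) * θ) * W (s₀ / 2) i j ≤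
      (∑ i, ∑ j, χ i * χ j * Real.cos ((((i.val : ℤ) - j.val : ℤ) : ℝ) * θ) * K ((i.val : ℤ) - j.val)) +
        ∑ i, ∑ j, χ i * χ j * ε := by
    rw [← Finset.sum_add_distrib]
    refine Finset.sum_le_sum fun i _ => ?_
    rw [← Finset.sum_add_distrib]
    exact Finset.sum_le_sum fun j _ => h2 i j
  -- re-index the two window sums by `range M`
  have h4 : ∑ i, ∑ j, χ i * χ j * Real.cos ((((i.val : ℤ) - j.val : ℤ) : ℝ) * θ) * K ((i.val : ℤ) - j.val) =
      ∑ a ∈ range M, ∑ b ∈ range M, K ((a : ℤ) - b) * Real.cos ((((a : ℤ) - b : ℤ) : ℝ) * θ) := by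
    have := sum_sum_window hAM (fun n m : ℕ => Real.cos ((((n : ℤ) - m : ℤ) : ℝ) * θ) * K ((n : ℤ) - m))
    simp only [hχ]
    rw [show (∑ i : Fin (N + 1), ∑ j : Fin (N + 1), (if R + 1 ≤ i.val ∧ i.val < R + 1 + M then (1 : ℝ) else 0) *
        (if R + 1 ≤ j.val ∧ j.val < R + 1 + M then (1 : ℝ) else 0) *
        Real.cos ((((i.val : ℤ) - j.val : ℤ) : ℝ) * θ) * K ((i.val : ℤ) - j.val)) =
        ∑ i : Fin (N + 1), ∑ j : Fin (N + 1), (if R + 1 ≤ i.val ∧ i.val < R + 1 + M then (1 : ℝ) else 0) *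
        (if R + 1 ≤ j.val ∧ j.val < R + 1 + M then (1 : ℝ) else 0) *
        (fun n m : ℕ => Real.cos ((((n : ℤ) - m : ℤ) : ℝ) * θ) * K ((n : ℤ) - m)) i.val j.val from
      Finset.sum_congr rfl fun i _ => Finset.sum_congr rfl fun j _ => by ring]
    rw [this]
    refine Finset.sum_congr rfl fun a _ => Finset.sum_congr rfl fun b _ => ?_
    have e1 : (((R + 1 + a : ℕ) : ℤ) - ((R + 1 + b : ℕ) : ℤ)) = (a : ℤ) - b := by push_cast; ring
    simp only [e1]
    ring
  have h5 : ∑ i, ∑ j, χ i * χ j * ε = (M : ℝ) ^ 2 * ε := by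
    have hχsum : ∑ i, χ i = M := by
      have := sum_window hAM (fun _ => (1 : ℝ))
      simp only [Finset.sum_const, Finset.card_range, nsmul_eq_mul, mul_one] at this
      rw [← this, hχ]
    have : ∑ i, ∑ j, χ i * χ j * ε = (∑ i, χ i) * (∑ j, χ j) * ε := by
      rw [Finset.sum_mul, Finset.sum_mul]
      refine Finset.sum_congr rfl fun i _ => ?_
      rw [Finset.mul_sum, Finset.sum_mul]
    rw [this, hχsum]
    ring
  linarith [h1, h3, h4, h5]

/-- **Nonnegativity of the bulk symbol** (the lower half of the registered stub `stub_symbolPositivity`, same hypotheses):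
for `pinnedChain ω₂ lam β γ` (all `> 0`) and `T > 0`, every summable `K : ℤ → ℝ` that is a bulk Toeplitz limit of the
block memory matrix `W_N(s)` in the sense of `stub_bulkLimit` has `Σ'_z K(z) cos(zθ) ≥ 0` at every `θ`. The strict
inequality (absence of a zero of the symbol) is the open content of the stub. -/
theorem symbol_nonneg_of_bulkLimit : ∀ ω₂ lam β γ : ℝ, 0 < ω₂ → 0 < lam → 0 < β → 0 < γ → ∀ T : ℝ, 0 < T →
    ∀ K : ℤ → ℝ, Summable K →
    (∀ ε : ℝ, 0 < ε → ∀ Z : ℕ, ∃ R : ℕ, ∀ N : ℕ, 2 ≤ N → ∃ s₀ : ℝ, 0 < s₀ ∧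
    ∀ (lap : ℝ → (PhaseSpace N → ℝ) → (PhaseSpace N → ℝ) → ℝ) (e : Fin N → PhaseSpace N → ℝ)
      (G : ℝ → Matrix (Fin N) (Fin N) ℝ) (schur : ℝ → (PhaseSpace N → ℝ) → (PhaseSpace N → ℝ) → ℝ)
      (g : Fin (N + 1) → PhaseSpace N → ℝ) (W : ℝ → Fin (N + 1) → Fin (N + 1) → ℝ),
    (∀ s f₁ f₂, lap s f₁ f₂ = ∫ t in Set.Ioi (0 : ℝ), Real.exp (-(s * t)) *
      ((∫ z, f₁ z * (∫ y, f₂ y ∂((pinnedChain ω₂ lam β γ).transitionKernel N T T t.toNNReal z))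
          ∂(pinnedChain ω₂ lam β γ).gibbsMeasure N T) -
        (∫ z, f₁ z ∂(pinnedChain ω₂ lam β γ).gibbsMeasure N T) *
          (∫ z, f₂ z ∂(pinnedChain ω₂ lam β γ).gibbsMeasure N T))) →
    (∀ x z, e x z = z.2 x ^ 2 / 2 + (pinnedChain ω₂ lam β γ).U (z.1 x) +
      ∑ j : Fin N, ((if j.val = x.val + 1 then (pinnedChain ω₂ lam β γ).V (z.1 j - z.1 x) / 2 else 0) +
        (if x.val = j.val + 1 then (pinnedChain ω₂ lam β γ).V (z.1 x - z.1 j) / 2 else 0))) →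
    (∀ s, G s = Matrix.of fun x y => lap s (e x) (e y)) →
    (∀ s f₁ f₂, schur s f₁ f₂ = lap s f₁ f₂ - ∑ x, ∑ y, lap s f₁ (e x) * (G s)⁻¹ x y * lap s (e y) f₂) →
    (∀ i z, g i z = (∑ b : Fin N, if b.val + 1 = i.val then (pinnedChain ω₂ lam β γ).bondCurrent N b z else 0) +
      (∑ x : Fin N, if (i.val = 0 ∧ x.val = 0) ∨ (i.val = N ∧ x.val + 1 = N) then
        (pinnedChain ω₂ lam β γ).γ * (T - z.2 x ^ 2) else 0)) →
    (∀ s i j, W s i j = (if i = j ∧ (i.val = 0 ∨ i.val = N) then (pinnedChain ω₂ lam β γ).γ * T ^ 2 else 0) -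
      schur s (fun z => g i (z.1, -z.2)) (g j)) →
    ∀ s : ℝ, 0 < s → s < s₀ → ∀ i j : Fin (N + 1),
      R + 1 ≤ i.val → i.val + 1 + R ≤ N → R + 1 ≤ j.val → j.val + 1 + R ≤ N →
      i.val ≤ j.val + Z → j.val ≤ i.val + Z → |W s i j - K ((i.val : ℤ) - j.val)| ≤ ε) →
    ∀ θ : ℝ, 0 ≤ ∑' z : ℤ, K z * Real.cos (z * θ) := by
  intro ω₂ lam β γ hω hl hβ hγ T hT K hK hlim θ
  have ha : Summable (fun z : ℤ => K z * Real.cos (z * θ)) :=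
    Summable.of_norm_bounded hK.norm fun z => by
      rw [norm_mul]
      exact mul_le_of_le_one_right (norm_nonneg _) (by simpa using Real.abs_cos_le_one (z * θ))
  refine tsum_nonneg_of_sections (fun z : ℤ => K z * Real.cos (z * θ)) ha fun M => ?_
  show 0 ≤ ∑ a ∈ range M, ∑ b ∈ range M, K ((a : ℤ) - b) * Real.cos ((((a : ℤ) - b : ℤ) : ℝ) * θ)
  -- the Fejér sum of length `M` is `≥ -M²ε` for every `ε > 0`
  have hwin : ∀ ε : ℝ, 0 < ε →
      -((M : ℝ) ^ 2 * ε) ≤ ∑ a ∈ range M, ∑ b ∈ range M, K ((a : ℤ) - b) * Real.cos ((((a : ℤ) - b : ℤ) : ℝ) * θ) := by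
    intro ε hε
    obtain ⟨R, hR⟩ := hlim ε hε M
    have hN : 2 ≤ 2 * R + 2 + M := by omega
    obtain ⟨s₀, hs₀, hNs⟩ := hR (2 * R + 2 + M) hN
    exact fejer_window hω hl hβ hγ hT hN K θ ε s₀ hs₀ R M M le_rfl le_rfl hNs _ _ _ _ _ _ (fun _ _ _ => rfl) (fun _ _ => rfl)
      (fun _ => rfl) (fun _ _ _ => rfl) (fun _ _ => rfl) (fun _ _ _ => rfl)
  refine le_of_forall_pos_lt_add fun ε' hε' => ?_
  have hM1 : (0 : ℝ) < (M : ℝ) ^ 2 + 1 := by positivity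
  have h := hwin (ε' / (2 * ((M : ℝ) ^ 2 + 1))) (by positivity)
  have hfrac : (M : ℝ) ^ 2 * (ε' / (2 * ((M : ℝ) ^ 2 + 1))) ≤ ε' / 2 := by
    rw [show (M : ℝ) ^ 2 * (ε' / (2 * ((M : ℝ) ^ 2 + 1))) = (ε' / 2) * ((M : ℝ) ^ 2 / ((M : ℝ) ^ 2 + 1)) by
      field_simp]
    have : (M : ℝ) ^ 2 / ((M : ℝ) ^ 2 + 1) ≤ 1 := (div_le_one hM1).2 (by linarith)
    have hε2 : 0 ≤ ε' / 2 := by positivity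
    nlinarith
  linarith

end Summit.AtomisticToContinuum.FouriersLaw.Theorems.HonestZwanzig.Robin

end
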